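import Summits.Langlands.Langlands.Theses.HeckeFieldDeRham
import Summits.Langlands.Langlands.Theorems.IrreducibilityBySelfDualityReciprocityUpToIrreducibilityCorrespondsConj
import HarnessLib

/-!
# `HeckeFieldDeRham.ReciprocityModuloDeRham` from its leaves (crux-strategist decomposition, stmt-Langlands-17410)

Support file for the crux `ReciprocityModuloDeRham` (RMD, item stmt-Langlands-17410) of route HeckeFieldDeRham: the
glue of its typed partition along the seams of the conjecture (direction / locality), MODULO DE RHAM —

* W⁺  `SatakeAvatarExistence` (VERBATIM item stmt-Langlands-17415 of route PrimeSwitchSplit): every L-algebraic cuspidal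
  `π` of `GL_n(𝔸_K)` has an IRREDUCIBLE `ℓ`-adic avatar, Satake–Frobenius compatible at almost all places;
* B_w `WeakGeometricAutomorphy` (VERBATIM item stmt-Langlands-17414): Fontaine–Mazur–Langlands, almost-everywhere form;
* LGC° `PairCompatibilityModuloDeRham` (new leaf): for one reciprocity datum per field, Taylor's Conj. 7 for irreducible
  Satake-compatible pairs at every finite place where the de Rham condition holds (vacuous at `v ∤ ℓ`);

and the uniqueness clause of (A°), which is a THEOREM of the tree
(`ReciprocityUpToIrreducibility.isConjugate_of_satakeFrobCompatibleAt`: Chebotarev + Brauer–Nesbitt, Deligne–Serre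
Lemme 3.2).  `reciprocityModuloDeRham_of_leaves : W⁺ → B_w → LGC° → ReciprocityModuloDeRham` is the glue theorem for
`ledger route edit --split ReciprocityModuloDeRham` (hypotheses stated as TEXTS, so that the route's children
`HeckeFieldDeRham.SatakeAvatarExistence` … unfold to them definitionally).  The second theorem
`reciprocityModuloDeRhamForall_of_leaves` is the same glue for the `∀ Rec` (lock-step) re-type of the crux that the
2026-08-17 summit re-type (p141787: `∃ 𝓡 ↦ Nonempty (ReciprocityData F) ∧ ∀ 𝓡`) calls for, from the `∀ Rec` form of
LGC° and the non-vacuity leaf `Nonempty (ReciprocityData K)`; its conclusion is stated as a text (no such decl yet).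
No `sorry`, no new definition; axioms propext / Classical.choice / Quot.sound.

## References

* K. Buzzard, T. Gee, *The conjectural connections between automorphic representations and Galois
  representations*, LMS Lecture Notes 414 (2014), Conj. 3.2.1–3.2.2. [BuzzardGeeLMS2014]
* J.-M. Fontaine, B. Mazur, *Geometric Galois representations* (1995), Conj. 1. [FontaineMazurGeometric1995]
* P. Deligne, J.-P. Serre, *Formes modulaires de poids 1*, ASENS 7 (1974), Lemme 3.2. [DeligneSerreASENS1974]
* R. Taylor, *Galois representations*, Ann. Fac. Sci. Toulouse 13 (2004), Conj. 7–8. [TaylorGaloisRepresentations2004]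
-/

noncomputable section

set_option linter.dupNamespace false

open scoped MatrixGroups Matrix NumberField Classical
open Filter IsDedekindDomain Field
open Literature.NumberTheory.Automorphic Literature.NumberTheory.GaloisRepresentations

namespace Summit.Langlands.Langlands.Theorems.HeckeFieldDeRham

open Summit.Langlands Summit.Langlands.Langlands.Theses.HeckeFieldDeRham

/-- **`ReciprocityModuloDeRham` from its three open leaves** (W⁺, B_w, LGC° as texts; uniqueness by the landed
Chebotarev–Brauer–Nesbitt theorem).  Pure logic: take `Rec` from LGC°; (A°) = the avatar of W⁺ + LGC° with the de Rham
hypothesis vacuous at `v ∤ ℓ` and supplied at `v ∣ ℓ` + `isConjugate_of_satakeFrobCompatibleAt` on `Corresponds.1` of the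
competitor; (B) = B_w (the pinned `Rec.pst` IS Fontaine's datum, `rfl`) + LGC° with de Rham from geometricity.
[cite: BuzzardGeeLMS2014, Conj. 3.2.2] [cite: DeligneSerreASENS1974, Lemme 3.2] -/
theorem reciprocityModuloDeRham_of_leaves
    (hW : ∀ (K : Type) [Field K] [NumberField K] (n : ℕ) (hcpt : Literature.NumberTheory.Automorphic.isCompact_glFiniteIntegralLevel n K), 0 < n → ∀ (π : Literature.NumberTheory.Automorphic.CuspidalAutomorphicRepData n K hcpt), π.1.IsLAlgebraic → ∀ (ℓ : ℕ) [Fact ℓ.Prime] (ι : PadicAlgCl ℓ ≃+* ℂ), ∃ ρ : Literature.NumberTheory.GaloisRepresentations.FramedGaloisRep K (PadicAlgCl ℓ) n, ρ.toGaloisRep.IsIrreducible ∧ ∀ᶠ v : IsDedekindDomain.HeightOneSpectrum (NumberField.RingOfIntegers K) in cofinite, SatakeFrobCompatibleAt ι π.1 ρ v)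
    (hB : ∀ (K : Type) [Field K] [NumberField K] (n : ℕ) (hcpt : Literature.NumberTheory.Automorphic.isCompact_glFiniteIntegralLevel n K), 0 < n → ∀ (ℓ : ℕ) [Fact ℓ.Prime] (ι : PadicAlgCl ℓ ≃+* ℂ) (ρ : Literature.NumberTheory.GaloisRepresentations.FramedGaloisRep K (PadicAlgCl ℓ) n), ρ.toGaloisRep.IsIrreducible → ((∀ᶠ v : IsDedekindDomain.HeightOneSpectrum (NumberField.RingOfIntegers K) in cofinite, ρ.IsUnramifiedAt v) ∧ ∀ (v : IsDedekindDomain.HeightOneSpectrum (NumberField.RingOfIntegers K)) (hv : ((ℓ : ℕ) : NumberField.RingOfIntegers K) ∈ v.asIdeal), (Literature.NumberTheory.PAdicHodge.fontainePstAdicCompletion v ℓ hv).IsDeRhamFramed (ρ.toLocal v)) → ∃ π : Literature.NumberTheory.Automorphic.CuspidalAutomorphicRepData n K hcpt, π.1.IsLAlgebraic ∧ ∀ᶠ v : IsDedekindDomain.HeightOneSpectrum (NumberField.RingOfIntegers K) in cofinite, SatakeFrobCompatibleAt ι π.1 ρ v)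
    (hL : ∀ (K : Type) [Field K] [NumberField K], ∃ Rec : ReciprocityData K, ∀ (n : ℕ) (hcpt : Literature.NumberTheory.Automorphic.isCompact_glFiniteIntegralLevel n K), 0 < n → ∀ (π : Literature.NumberTheory.Automorphic.CuspidalAutomorphicRepData n K hcpt), π.1.IsLAlgebraic → ∀ (ℓ : ℕ) [Fact ℓ.Prime] (ι : PadicAlgCl ℓ ≃+* ℂ) (ρ : Literature.NumberTheory.GaloisRepresentations.FramedGaloisRep K (PadicAlgCl ℓ) n), ρ.toGaloisRep.IsIrreducible → (∀ᶠ v : IsDedekindDomain.HeightOneSpectrum (NumberField.RingOfIntegers K) in cofinite, SatakeFrobCompatibleAt ι π.1 ρ v) → ∀ v : IsDedekindDomain.HeightOneSpectrum (NumberField.RingOfIntegers K), (∀ hv : ((ℓ : ℕ) : NumberField.RingOfIntegers K) ∈ v.asIdeal, (Rec.pst ℓ v hv).IsDeRhamFramed (ρ.toLocal v)) → LocalGlobalCompatibleAt Rec ι π.1 ρ v) :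
    Summit.Langlands.Langlands.Theses.HeckeFieldDeRham.ReciprocityModuloDeRham := by
  intro F _ _
  obtain ⟨Rec, hRec⟩ := hL F
  refine ⟨Rec, fun n hn hcpt => ⟨?_, ?_⟩⟩
  · intro π hπ ℓ _ ι
    obtain ⟨ρ, hirr, hsat⟩ := hW F n hcpt hn π hπ ℓ ι
    refine ⟨ρ, hirr, hsat, ?_, ?_, ?_⟩
    · intro v hv
      exact hRec n hcpt hn π hπ ℓ ι ρ hirr hsat v (fun hv' => absurd hv' hv)
    · intro v hv hdR
      exact hRec n hcpt hn π hπ ℓ ι ρ hirr hsat v (fun _ => hdR)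
    · intro ρ' hρ'
      exact Theorems.ReciprocityUpToIrreducibility.isConjugate_of_satakeFrobCompatibleAt π.1 ι hirr hsat hρ'.1
  · intro ℓ _ ι ρ hirr hgeo
    obtain ⟨π, hπ, hsat⟩ := hB F n hcpt hn ℓ ι ρ hirr ⟨hgeo.1, fun v hv => hgeo.2 v hv⟩
    exact ⟨π, hπ, hsat, fun v => hRec n hcpt hn π hπ ℓ ι ρ hirr hsat v (fun hv => hgeo.2 v hv)⟩

/-- **The same glue for the `∀ Rec` re-type of the crux** (lock-step with the re-typed summit, p141787): from the
non-vacuity leaf `Nonempty (ReciprocityData K)`, W⁺, B_w and the `∀ Rec` form of LGC°, the text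
`∀ F, Nonempty (ReciprocityData F) ∧ ∀ Rec n, 0 < n → ∀ hcpt, (A°)(Rec) ∧ GaloisToAutomorphic n Rec hcpt`.
[cite: BuzzardGeeLMS2014, Conj. 3.2.2] [cite: DeligneSerreASENS1974, Lemme 3.2] -/
theorem reciprocityModuloDeRhamForall_of_leaves
    (hN : ∀ (K : Type) [Field K] [NumberField K], Nonempty (ReciprocityData K))
    (hW : ∀ (K : Type) [Field K] [NumberField K] (n : ℕ) (hcpt : Literature.NumberTheory.Automorphic.isCompact_glFiniteIntegralLevel n K), 0 < n → ∀ (π : Literature.NumberTheory.Automorphic.CuspidalAutomorphicRepData n K hcpt), π.1.IsLAlgebraic → ∀ (ℓ : ℕ) [Fact ℓ.Prime] (ι : PadicAlgCl ℓ ≃+* ℂ), ∃ ρ : Literature.NumberTheory.GaloisRepresentations.FramedGaloisRep K (PadicAlgCl ℓ) n, ρ.toGaloisRep.IsIrreducible ∧ ∀ᶠ v : IsDedekindDomain.HeightOneSpectrum (NumberField.RingOfIntegers K) in cofinite, SatakeFrobCompatibleAt ι π.1 ρ v)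
    (hB : ∀ (K : Type) [Field K] [NumberField K] (n : ℕ) (hcpt : Literature.NumberTheory.Automorphic.isCompact_glFiniteIntegralLevel n K), 0 < n → ∀ (ℓ : ℕ) [Fact ℓ.Prime] (ι : PadicAlgCl ℓ ≃+* ℂ) (ρ : Literature.NumberTheory.GaloisRepresentations.FramedGaloisRep K (PadicAlgCl ℓ) n), ρ.toGaloisRep.IsIrreducible → ((∀ᶠ v : IsDedekindDomain.HeightOneSpectrum (NumberField.RingOfIntegers K) in cofinite, ρ.IsUnramifiedAt v) ∧ ∀ (v : IsDedekindDomain.HeightOneSpectrum (NumberField.RingOfIntegers K)) (hv : ((ℓ : ℕ) : NumberField.RingOfIntegers K) ∈ v.asIdeal), (Literature.NumberTheory.PAdicHodge.fontainePstAdicCompletion v ℓ hv).IsDeRhamFramed (ρ.toLocal v)) → ∃ π : Literature.NumberTheory.Automorphic.CuspidalAutomorphicRepData n K hcpt, π.1.IsLAlgebraic ∧ ∀ᶠ v : IsDedekindDomain.HeightOneSpectrum (NumberField.RingOfIntegers K) in cofinite, SatakeFrobCompatibleAt ι π.1 ρ v)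
    (hL : ∀ (K : Type) [Field K] [NumberField K] (Rec : ReciprocityData K) (n : ℕ) (hcpt : Literature.NumberTheory.Automorphic.isCompact_glFiniteIntegralLevel n K), 0 < n → ∀ (π : Literature.NumberTheory.Automorphic.CuspidalAutomorphicRepData n K hcpt), π.1.IsLAlgebraic → ∀ (ℓ : ℕ) [Fact ℓ.Prime] (ι : PadicAlgCl ℓ ≃+* ℂ) (ρ : Literature.NumberTheory.GaloisRepresentations.FramedGaloisRep K (PadicAlgCl ℓ) n), ρ.toGaloisRep.IsIrreducible → (∀ᶠ v : IsDedekindDomain.HeightOneSpectrum (NumberField.RingOfIntegers K) in cofinite, SatakeFrobCompatibleAt ι π.1 ρ v) → ∀ v : IsDedekindDomain.HeightOneSpectrum (NumberField.RingOfIntegers K), (∀ hv : ((ℓ : ℕ) : NumberField.RingOfIntegers K) ∈ v.asIdeal, (Rec.pst ℓ v hv).IsDeRhamFramed (ρ.toLocal v)) → LocalGlobalCompatibleAt Rec ι π.1 ρ v) :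
    ∀ (F : Type) [Field F] [NumberField F], Nonempty (Summit.Langlands.ReciprocityData F) ∧ ∀ (Rec : Summit.Langlands.ReciprocityData F) (n : ℕ), 0 < n → ∀ hcpt : Literature.NumberTheory.Automorphic.isCompact_glFiniteIntegralLevel n F, (∀ π : Literature.NumberTheory.Automorphic.CuspidalAutomorphicRepData n F hcpt, π.1.IsLAlgebraic → ∀ (ℓ : ℕ) [Fact ℓ.Prime] (ι : PadicAlgCl ℓ ≃+* ℂ), ∃ ρ : Literature.NumberTheory.GaloisRepresentations.FramedGaloisRep F (PadicAlgCl ℓ) n, ρ.toGaloisRep.IsIrreducible ∧ (∀ᶠ v : IsDedekindDomain.HeightOneSpectrum (NumberField.RingOfIntegers F) in Filter.cofinite, Summit.Langlands.SatakeFrobCompatibleAt ι π.1 ρ v) ∧ (∀ v : IsDedekindDomain.HeightOneSpectrum (NumberField.RingOfIntegers F), ((ℓ : ℕ) : NumberField.RingOfIntegers F) ∉ v.asIdeal → Summit.Langlands.LocalGlobalCompatibleAt Rec ι π.1 ρ v) ∧ (∀ (v : IsDedekindDomain.HeightOneSpectrum (NumberField.RingOfIntegers F)) (hv : ((ℓ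 : ℕ) : NumberField.RingOfIntegers F) ∈ v.asIdeal), (Rec.pst ℓ v hv).IsDeRhamFramed (ρ.toLocal v) → Summit.Langlands.LocalGlobalCompatibleAt Rec ι π.1 ρ v) ∧ (∀ ρ' : Literature.NumberTheory.GaloisRepresentations.FramedGaloisRep F (PadicAlgCl ℓ) n, Summit.Langlands.Corresponds Rec ι π.1 ρ' → Summit.Langlands.IsConjugate ρ ρ')) ∧ Summit.Langlands.GaloisToAutomorphic n Rec hcpt := by
  intro F _ _
  refine ⟨hN F, fun Rec n hn hcpt => ⟨?_, ?_⟩⟩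
  · intro π hπ ℓ _ ι
    obtain ⟨ρ, hirr, hsat⟩ := hW F n hcpt hn π hπ ℓ ι
    refine ⟨ρ, hirr, hsat, ?_, ?_, ?_⟩
    · intro v hv
      exact hL F Rec n hcpt hn π hπ ℓ ι ρ hirr hsat v (fun hv' => absurd hv' hv)
    · intro v hv hdR
      exact hL F Rec n hcpt hn π hπ ℓ ι ρ hirr hsat v (fun _ => hdR)
    · intro ρ' hρ'
      exact Theorems.ReciprocityUpToIrreducibility.isConjugate_of_satakeFrobCompatibleAt π.1 ι hirr hsat hρ'.1
  · intro ℓ _ ι ρ hirr hgeo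
    obtain ⟨π, hπ, hsat⟩ := hB F n hcpt hn ℓ ι ρ hirr ⟨hgeo.1, fun v hv => hgeo.2 v hv⟩
    exact ⟨π, hπ, hsat, fun v => hL F Rec n hcpt hn π hπ ℓ ι ρ hirr hsat v (fun hv => hgeo.2 v hv)⟩

end Summit.Langlands.Langlands.Theorems.HeckeFieldDeRham
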